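import Summits.BirchSwinnertonDyer.Rank1Residual.TwoVariableOrdinaryMainConjecture
import Summits.BirchSwinnertonDyer.Rank1Residual.TwoVariableGreenbergMainConjectureAnyRoot
import Literature.NumberTheory.EllipticCurves.BurungaleSkinnerTianWan2024.OrdinaryTwoVariableMainStatementSemistableOPEN
import Literature.NumberTheory.EllipticCurves.YanZhu2026.HidaRankinLFunctionExistence
import HarnessLib

/-!
# Edges (theorems only): the two-variable main-conjecture leaves AT a datum —
# `TwoVariableIMC.OrdinaryTwoVariableMainConjectureAt` (BCS25 statement 4.1.1 = Yan–Zhu 4.1 (1)) and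
# `TwoVariableIMC.GreenbergTwoVariableMainConjectureAnyRootAt` (BCS25 statement 4.1.2 = Yan–Zhu 4.1 (2))
# — on the SEMISTABLE (def)/(indef) locus `N⁻ ≠ 1`, from ONE preprint binder each
# (Burungale–Skinner–Tian–Wan arXiv:2409.01350v2 Thm. 10.10 (b), typed in
# `Literature/…/BurungaleSkinnerTianWan2024/OrdinaryTwoVariableMainStatementSemistableOPEN.lean`)
# plus a frame element (refereed existence: Yan–Zhu Thm. 3.3 / Thm. 3.9)

Filed by the typer seat `bsd-littype-01` (gen 7) of the cross-ladder literature-typing layer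
(D-0088(4); cell `run/shared/lean/pub/bsd-littype/`), next to seat `bsd-littype-03`'s leaves and their
`…Edges.lean` files (theirs untouched). HONEST FRAMING: theorems only; no definition, no named fact, no
`sorry`; every result is CONDITIONAL on an explicitly labelled OPEN binder of an UNREFEREED preprint
(`[claim: BurungaleSkinnerTianWan2024, status: under-review]`) and closes NOTHING; BSD is not advanced
by a conditional edge. What the edges record: the known loci of the two leaves so far were the
HEEGNER locus (every `ℓ ∣ N` split in `K`: `of_yanZhu_thm42_of_bigIm`, `of_thm141_of_surj`, refereed)
and the Eisenstein locus (CGS25); Thm. 10.10 (b) lives on the DISJOINT locus `N⁻ ≠ 1` — `N`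
square-free, `p ∤ 2N` ordinary, (irr_ℚ), `(D_L, 2N) = 1`, (ord), (irr_L), (def) or (indef)
(`BurungaleSkinnerTianWan2024.Thm1010bHypotheses`;
`Thm1010bHypotheses.not_satisfiesHeegnerHypothesis`) — at every `p ≠ 2` incl. `p = 3`, without
(Im)/(sur)/(disc).

* `ordinaryAt_of_thm1010b_OPEN` — granted the 9.10 (`∅`) binder and the BSTW hypotheses at
  `(E, N, p, L)`: for ANY frame element `F` of `(W, π.f)` with `IsCongruenceIntegral` (the leaf is
  ∃-form; the binder is ∀-form), the ordinary leaf holds at `(ι, W, K, κ₁, κ₂, γ₁, γ₂, π)`.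
  `ordinaryAt_of_thm1010b_OPEN_of_exists` — the same fed with an existence statement of the shape of
  Yan–Zhu Thm. 3.3 (`YanZhu2026.thm33_exists_isHidaRankinLFunction`, filed separately by this seat: the
  refereed, hypothesis-light supplier of `F` off the Heegner locus); `ordinaryAt_of_thm1010b_OPEN_of_thm33`
  — the same with that fact taken by NAME (v2 of this file, once the fact landed: p504643), so that the
  ordinary leaf on the (def)/(indef) locus rests on ONE preprint binder + ONE refereed named fact and no
  caller-supplied datum; `ordinaryAt_and_greenbergAt_of_thm1010b_OPEN_of_thm33_of_thm39` — both leaves so.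
* `GreenbergAnyRoot.of_thm1010b_OPEN_of_frames` — granted the 9.12 (`∅`) binder: for ANY Katz frame
  and ANY reduction-type-free Greenberg frame element at the inverse generators, the Greenberg leaf
  holds; `GreenbergAnyRoot.of_thm1010b_OPEN_of_thm39` — the frames supplied by the refereed
  `YanZhu2026.thm39_def311_exists_isGreenbergLFunctionAnyRoot₂` under `GreenbergSetting` (which carries
  Yan–Zhu's (disc): `D_K` odd, `≠ −3`).

References: [BurungaleSkinnerTianWan2024] Thm. 10.10 (b) (p. 89), statements 9.10 / 9.12 (p. 81),
(def)/(indef) (Thm. 10.5, p. 87); [BurungaleCastellaSkinner2025] statements 4.1.1 / 4.1.2 (§4.1, p. 8);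
[YanZhu2024MainConjNonCM] 4.1, Thm. 3.3, Thm. 3.9 / Def. 3.11.
-/

noncomputable section

open scoped Classical

open PowerSeries NumberField IsDedekindDomain Field CongruenceSubgroup
  Literature.NumberTheory.GaloisRepresentations Literature.NumberTheory.EllipticCurves
  Literature.NumberTheory.EllipticCurves.ModularForms Literature.NumberTheory.EllipticCurves.Rank1Residual
  Literature.NumberTheory.EllipticCurves.IwasawaAlgebra₂
  Literature.NumberTheory.EllipticCurves.YanZhu2026
  Literature.NumberTheory.EllipticCurves.BurungaleSkinnerTianWan2024

namespace Summit.BirchSwinnertonDyer.Rank1Residual.TwoVariableIMC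

variable {p : ℕ} [Fact p.Prime] {K : Type} [Field K] [NumberField K]

/-! ### The ordinary leaf on the (def)/(indef) locus -/

/-- **BSTW Thm. 10.10 (b) [OPEN binder, 9.10 case `· = ∅`] ⟹ statement 4.1.1 AT `(E, K, p)`** on the
semistable (def)/(indef) locus (`Thm1010bHypotheses W p N K`), for ANY frame element `F = 𝓛_p^I(f_E/K)`
with `IsHidaRankinLFunction ι W κ₁ κ₂ π.f F` and `IsCongruenceIntegral π.f F` (the leaf asks for one; the
binder gives the equality for every one). CONDITIONAL on the preprint binder; closes nothing.
[claim: BurungaleSkinnerTianWan2024, status: under-review]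
[cite: BurungaleSkinnerTianWan2024, Thm. 10.10 (b) (p. 89) with statement 9.10 (p. 81), case · = ∅ (OPEN binder; edge)]
[cite: BurungaleCastellaSkinner2025, statement 4.1.1 (§4.1, p. 8 of arXiv:2405.00270v2)] -/
theorem ordinaryAt_of_thm1010b_OPEN (hBSTW_OPEN : thm1010b_standardMainStatement_twoVariable_OPEN)
    (ι : integralClosure ℚ ℂ →+* ℂ_[p]) (W : WeierstrassCurve ℚ) [W.IsElliptic] [W.IsGloballyMinimal]
    (κ₁ κ₂ : ZpExtension K p) (γ₁ γ₂ : absoluteGaloisGroup K)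
    [Fact (ZpExtension.IsTopGeneratorPair κ₁ κ₂ γ₁ γ₂)] {N : ℕ} [NeZero N]
    (π : ModularParametrizationData W N) (hyp : Thm1010bHypotheses W p N K) {F : CycAntiSeries p}
    (hF : IsHidaRankinLFunction ι W κ₁ κ₂ π.f F) (hcF : IsCongruenceIntegral π.f F) :
    OrdinaryTwoVariableMainConjectureAt ι W K κ₁ κ₂ γ₁ γ₂ π := by
  obtain ⟨htor, hmc⟩ := hBSTW_OPEN ι W K κ₁ κ₂ γ₁ γ₂ π hyp
  obtain ⟨hle, hge⟩ := hmc F hF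
  exact ⟨F, hF, hcF, htor, hle, hge⟩

/-- **The same, fed with an existence statement of Yan–Zhu Thm. 3.3's shape** (`∃ F,
IsHidaRankinLFunction … ∧ IsCongruenceIntegral …` — e.g. from the refereed
`YanZhu2026.thm33_exists_isHidaRankinLFunction` at `(W, π.f)`, whose hypotheses `3 ≤ p`, `GoodOrd`,
`IsImaginaryQuadratic`, split `p`, `(N, D_K) = 1` all follow from `Thm1010bHypotheses`). CONDITIONAL on
the preprint binder; closes nothing. [claim: BurungaleSkinnerTianWan2024, status: under-review]
[cite: BurungaleSkinnerTianWan2024, Thm. 10.10 (b) (p. 89) with statement 9.10 (p. 81), case · = ∅ (OPEN binder; edge)]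
[cite: YanZhu2024MainConjNonCM, Thm. 3.3 (arXiv:2412.20078v4 TeX l.738–752) (the supplier of F)] -/
theorem ordinaryAt_of_thm1010b_OPEN_of_exists
    (hBSTW_OPEN : thm1010b_standardMainStatement_twoVariable_OPEN)
    (ι : integralClosure ℚ ℂ →+* ℂ_[p]) (W : WeierstrassCurve ℚ) [W.IsElliptic] [W.IsGloballyMinimal]
    (κ₁ κ₂ : ZpExtension K p) (γ₁ γ₂ : absoluteGaloisGroup K)
    [Fact (ZpExtension.IsTopGeneratorPair κ₁ κ₂ γ₁ γ₂)] {N : ℕ} [NeZero N]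
    (π : ModularParametrizationData W N) (hyp : Thm1010bHypotheses W p N K)
    (hex : ∃ F : CycAntiSeries p, IsHidaRankinLFunction ι W κ₁ κ₂ π.f F ∧ IsCongruenceIntegral π.f F) :
    OrdinaryTwoVariableMainConjectureAt ι W K κ₁ κ₂ γ₁ γ₂ π := by
  obtain ⟨F, hF, hcF⟩ := hex
  exact ordinaryAt_of_thm1010b_OPEN hBSTW_OPEN ι W κ₁ κ₂ γ₁ γ₂ π hyp hF hcF

/-- The hypotheses of Thm. 10.10 (b) supply the (weaker) hypotheses under which Yan–Zhu Thm. 3.3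
delivers a frame element: `3 ≤ p`, good ordinary, `K` imaginary quadratic, `p` split, `(N, D_K) = 1`.
[cite: BurungaleSkinnerTianWan2024, Thm. 10.10, preamble and (b) (p. 89) (bookkeeping)]
[cite: YanZhu2024MainConjNonCM, §2 l.440–442, §2.1 l.468 of arXiv:2412.20078v4 (the setting of Thm. 3.3)] -/
theorem thm33Setting_of_thm1010bHypotheses {W : WeierstrassCurve ℚ} [W.IsGloballyMinimal] {N : ℕ}
    (hyp : Thm1010bHypotheses W p N K) :
    (N : ℤ) = W.conductorNorm ℤ ∧ 3 ≤ p ∧ GoodOrd W p ∧ IsImaginaryQuadratic K ∧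
      ((Ideal.span {(p : ℤ)}).primesOver (𝓞 K)).ncard = 2 ∧ IsCoprime (N : ℤ) (NumberField.discr K) := by
  refine ⟨hyp.level, ?_, hyp.goodOrd, hyp.isImaginaryQuadratic, hyp.split, hyp.coprime.of_mul_left_right⟩
  have h2 := (Fact.out : p.Prime).two_le
  have hne := hyp.two_ne
  omega

/-! ### The Greenberg leaf on the (def)/(indef) locus -/

namespace GreenbergAnyRoot

/-- **BSTW Thm. 10.10 (b) [OPEN binder, 9.12 case `· = ∅`] ⟹ statement 4.1.2 AT `(E, K, p)`**, for
ANY Katz frame `LK` with period data and ANY reduction-type-free Greenberg frame element `G` at the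
inverse generators (`IsGreenbergLFunctionAnyRoot₂ … γ₁⁻¹ γ₂⁻¹ f …`): on the semistable (def)/(indef)
locus, with `v ≠ v̄` over `p`, `v` induced by `ι`, `(κ₁, κ₂)` cyclotomic/anticyclotomic, the Greenberg
leaf holds. No (disc) needed in this form. CONDITIONAL on the preprint binder; closes nothing.
[claim: BurungaleSkinnerTianWan2024, status: under-review]
[cite: BurungaleSkinnerTianWan2024, Thm. 10.10 (b) (p. 89) with statement 9.12 (p. 81), case · = ∅ (OPEN binder; edge)]
[cite: BurungaleCastellaSkinner2025, statement 4.1.2 (§4.1, p. 8 of arXiv:2405.00270v2)] -/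
theorem of_thm1010b_OPEN_of_frames (hBSTW_OPEN : thm1010b_greenbergMainStatement_twoVariable_OPEN)
    (ι : PadicAlgCl p ≃+* ℂ) (W : WeierstrassCurve ℚ) [W.IsElliptic] [W.IsGloballyMinimal]
    (v vbar : HeightOneSpectrum (𝓞 K)) (κ₁ κ₂ : ZpExtension K p) (γ₁ γ₂ : absoluteGaloisGroup K)
    [Fact (ZpExtension.IsTopGeneratorPair κ₁ κ₂ γ₁ γ₂)] {N : ℕ} [NeZero N] {f : CuspForm (Gamma0 N) 2}
    (hf : IsNewformOf W f) [NeZero (NumberField.discr K).natAbs] (hyp : Thm1010bHypotheses W p N K)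
    (hv : ((p : ℕ) : 𝓞 K) ∈ v.asIdeal) (hvbar : ((p : ℕ) : 𝓞 K) ∈ vbar.asIdeal) (hne : vbar ≠ v)
    (hcompat : ∀ (w : InfinitePlace K) (k : 𝓞 K), k ∈ v.asIdeal ↔ ‖ι.symm (w.embedding (k : K))‖ < 1)
    (hκ₁ : κ₁.IsCyclotomic) (hκ₂ : κ₂.IsAnticyclotomic)
    {Ω δ : ℂ} {Ωp : (unrIntegers p)ˣ} {LK G : PowerSeries (PowerSeries (PadicComplexInt p))}
    (hΩ : Ω ≠ 0) (hδ : δ ^ 2 = (NumberField.discr K : ℂ) ∨ δ ^ 2 = -(NumberField.discr K : ℂ))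
    (hLK : IsKatzMeasure₂ ι v vbar ∅ κ₁ κ₂ γ₁⁻¹ γ₂⁻¹ 1 Ω δ ((Ωp : unrIntegers p) : ℂ_[p]) LK)
    (hG : IsGreenbergLFunctionAnyRoot₂ ι v vbar κ₁ κ₂ γ₁⁻¹ γ₂⁻¹ f (NumberField.discr K).natAbs
      (NumberField.classNumber K) LK G) :
    GreenbergTwoVariableMainConjectureAnyRootAt ι W K v vbar κ₁ κ₂ γ₁ γ₂ f := by
  obtain ⟨htor, hmc⟩ := hBSTW_OPEN ι W K v vbar κ₁ κ₂ γ₁ γ₂ hf hyp hv hvbar hne hcompat hκ₁ hκ₂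
  exact ⟨Ω, δ, Ωp, LK, G, hΩ, hδ, hLK, hG, htor, fun J hJ ↦ hmc Ω δ Ωp LK G hΩ hδ hLK hG J hJ⟩

/-- **BSTW Thm. 10.10 (b) [OPEN binder] + Yan–Zhu Thm. 3.9 / Def. 3.11 [REFEREED, frames] ⟹ statement
4.1.2 AT `(E, K, p)`** under Yan–Zhu's Greenberg standing data (`GreenbergSetting`: it supplies `v, v̄`,
the embedding compatibility, the cyclotomic/anticyclotomic coordinates — and carries (disc) `D_K` odd,
`≠ −3`, needed here ONLY for the existence of the frames) on the semistable (def)/(indef) locus. The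
first node of the Greenberg leaf OFF the Heegner locus. CONDITIONAL on the preprint binder; closes
nothing. [claim: BurungaleSkinnerTianWan2024, status: under-review]
[cite: BurungaleSkinnerTianWan2024, Thm. 10.10 (b) (p. 89) with statement 9.12 (p. 81), case · = ∅ (OPEN binder; edge)]
[cite: YanZhu2024MainConjNonCM, Thm. 3.9 with Def. 3.11 (arXiv:2412.20078v4 TeX l.839–871) (the supplier of the frames)] -/
theorem of_thm1010b_OPEN_of_thm39 (hBSTW_OPEN : thm1010b_greenbergMainStatement_twoVariable_OPEN)
    (h39 : thm39_def311_exists_isGreenbergLFunctionAnyRoot₂)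
    (ι : PadicAlgCl p ≃+* ℂ) (W : WeierstrassCurve ℚ) [W.IsElliptic] [W.IsGloballyMinimal]
    (v vbar : HeightOneSpectrum (𝓞 K)) (κ₁ κ₂ : ZpExtension K p) (γ₁ γ₂ : absoluteGaloisGroup K)
    [Fact (ZpExtension.IsTopGeneratorPair κ₁ κ₂ γ₁ γ₂)] {N : ℕ} [NeZero N] {f : CuspForm (Gamma0 N) 2}
    (hf : IsNewformOf W f) [NeZero (NumberField.discr K).natAbs]
    (hS : GreenbergSetting ι W N K v vbar κ₁ κ₂) (hyp : Thm1010bHypotheses W p N K) :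
    GreenbergTwoVariableMainConjectureAnyRootAt ι W K v vbar κ₁ κ₂ γ₁ γ₂ f := by
  obtain ⟨Ω, δ, Ωp, LK, G, hΩ, hδ, hLK, hG⟩ := h39 ι W K v vbar κ₁ κ₂ γ₁ γ₂ hf hS
  exact of_thm1010b_OPEN_of_frames hBSTW_OPEN ι W v vbar κ₁ κ₂ γ₁ γ₂ hf hyp hS.mem_v hS.mem_vbar
    hS.vbar_ne hS.compat hS.cyclotomic hS.anticyclotomic hΩ hδ hLK hG

end GreenbergAnyRoot

/-! ### Both leaves at once on the (def)/(indef) locus -/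

/-- **Granted BOTH preprint binders of Thm. 10.10 (b) (`∅` cases), a frame element `F` of `(W, π.f)` with
`IsCongruenceIntegral`, and the refereed Greenberg frames (Yan–Zhu Thm. 3.9 under `GreenbergSetting`):
BOTH two-variable leaves hold AT `(E, K, p)`** on the semistable (def)/(indef) locus — the BCS25
statements 4.1.1 and 4.1.2 at the datum, off the Heegner locus, modulo the unrefereed preprint.
CONDITIONAL; closes nothing. [claim: BurungaleSkinnerTianWan2024, status: under-review]
[cite: BurungaleSkinnerTianWan2024, Thm. 10.10 (b) (p. 89) (OPEN binders; edge)]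
[cite: BurungaleCastellaSkinner2025, statements 4.1.1 and 4.1.2 (§4.1, p. 8 of arXiv:2405.00270v2)] -/
theorem ordinaryAt_and_greenbergAt_of_thm1010b_OPEN
    (hSt_OPEN : thm1010b_standardMainStatement_twoVariable_OPEN)
    (hGr_OPEN : thm1010b_greenbergMainStatement_twoVariable_OPEN)
    (h39 : thm39_def311_exists_isGreenbergLFunctionAnyRoot₂)
    (ι₁ : integralClosure ℚ ℂ →+* ℂ_[p]) (ι : PadicAlgCl p ≃+* ℂ) (W : WeierstrassCurve ℚ) [W.IsElliptic]
    [W.IsGloballyMinimal] (v vbar : HeightOneSpectrum (𝓞 K)) (κ₁ κ₂ : ZpExtension K p)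
    (γ₁ γ₂ : absoluteGaloisGroup K) [Fact (ZpExtension.IsTopGeneratorPair κ₁ κ₂ γ₁ γ₂)] {N : ℕ}
    [NeZero N] (π : ModularParametrizationData W N) [NeZero (NumberField.discr K).natAbs]
    (hS : GreenbergSetting ι W N K v vbar κ₁ κ₂) (hyp : Thm1010bHypotheses W p N K)
    {F : CycAntiSeries p} (hF : IsHidaRankinLFunction ι₁ W κ₁ κ₂ π.f F)
    (hcF : IsCongruenceIntegral π.f F) :
    OrdinaryTwoVariableMainConjectureAt ι₁ W K κ₁ κ₂ γ₁ γ₂ π ∧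
      GreenbergTwoVariableMainConjectureAnyRootAt ι W K v vbar κ₁ κ₂ γ₁ γ₂ π.f :=
  ⟨ordinaryAt_of_thm1010b_OPEN hSt_OPEN ι₁ W κ₁ κ₂ γ₁ γ₂ π hyp hF hcF,
    GreenbergAnyRoot.of_thm1010b_OPEN_of_thm39 hGr_OPEN h39 ι W v vbar κ₁ κ₂ γ₁ γ₂ π.isNewformOf hS hyp⟩

/-! ### v2: the ordinary leaf from the binder + Yan–Zhu Thm. 3.3 taken BY NAME -/

/-- **BSTW Thm. 10.10 (b) [OPEN binder, 9.10 case `· = ∅`] + Yan–Zhu Thm. 3.3 [REFEREED named fact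
`YanZhu2026.thm33_exists_isHidaRankinLFunction`] ⟹ statement 4.1.1 AT `(E, K, p)`** on the semistable
(def)/(indef) locus, for every modular parametrisation `π` at the conductor: the frame element is
supplied by the refereed fact, whose hypotheses follow from `Thm1010bHypotheses`
(`thm33Setting_of_thm1010bHypotheses`). No caller-supplied datum. CONDITIONAL on the preprint binder;
closes nothing. [claim: BurungaleSkinnerTianWan2024, status: under-review]
[cite: BurungaleSkinnerTianWan2024, Thm. 10.10 (b) (p. 89) with statement 9.10 (p. 81), case · = ∅ (OPEN binder; edge)]
[cite: YanZhu2024MainConjNonCM, Thm. 3.3 (arXiv:2412.20078v4 TeX l.738–752) (tree fact thm33_exists_isHidaRankinLFunction)] -/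
theorem ordinaryAt_of_thm1010b_OPEN_of_thm33
    (hBSTW_OPEN : thm1010b_standardMainStatement_twoVariable_OPEN)
    (h33 : thm33_exists_isHidaRankinLFunction)
    (ι : integralClosure ℚ ℂ →+* ℂ_[p]) (W : WeierstrassCurve ℚ) [W.IsElliptic] [W.IsGloballyMinimal]
    (κ₁ κ₂ : ZpExtension K p) (γ₁ γ₂ : absoluteGaloisGroup K)
    [Fact (ZpExtension.IsTopGeneratorPair κ₁ κ₂ γ₁ γ₂)] {N : ℕ} [NeZero N]
    (π : ModularParametrizationData W N) (hyp : Thm1010bHypotheses W p N K) :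
    OrdinaryTwoVariableMainConjectureAt ι W K κ₁ κ₂ γ₁ γ₂ π := by
  obtain ⟨hN, hp, hord, hK, hsplit, hcop⟩ := thm33Setting_of_thm1010bHypotheses (p := p) (K := K) hyp
  exact ordinaryAt_of_thm1010b_OPEN_of_exists hBSTW_OPEN ι W κ₁ κ₂ γ₁ γ₂ π hyp
    (h33 ι W K κ₁ κ₂ γ₁ γ₂ π.isNewformOf hN hp hord hK hsplit hcop)

/-- **Both leaves AT `(E, K, p)` on the semistable (def)/(indef) locus from the two preprint binders of
Thm. 10.10 (b) (`∅` cases) and two REFEREED named facts (Yan–Zhu Thm. 3.3 for the type-I frame element,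
Thm. 3.9 / Def. 3.11 for the Katz/Greenberg frames under `GreenbergSetting`)** — no caller-supplied
datum. CONDITIONAL; closes nothing. [claim: BurungaleSkinnerTianWan2024, status: under-review]
[cite: BurungaleSkinnerTianWan2024, Thm. 10.10 (b) (p. 89) (OPEN binders; edge)]
[cite: BurungaleCastellaSkinner2025, statements 4.1.1 and 4.1.2 (§4.1, p. 8 of arXiv:2405.00270v2)] -/
theorem ordinaryAt_and_greenbergAt_of_thm1010b_OPEN_of_thm33_of_thm39
    (hSt_OPEN : thm1010b_standardMainStatement_twoVariable_OPEN)
    (hGr_OPEN : thm1010b_greenbergMainStatement_twoVariable_OPEN)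
    (h33 : thm33_exists_isHidaRankinLFunction) (h39 : thm39_def311_exists_isGreenbergLFunctionAnyRoot₂)
    (ι₁ : integralClosure ℚ ℂ →+* ℂ_[p]) (ι : PadicAlgCl p ≃+* ℂ) (W : WeierstrassCurve ℚ) [W.IsElliptic]
    [W.IsGloballyMinimal] (v vbar : HeightOneSpectrum (𝓞 K)) (κ₁ κ₂ : ZpExtension K p)
    (γ₁ γ₂ : absoluteGaloisGroup K) [Fact (ZpExtension.IsTopGeneratorPair κ₁ κ₂ γ₁ γ₂)] {N : ℕ}
    [NeZero N] (π : ModularParametrizationData W N) [NeZero (NumberField.discr K).natAbs]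
    (hS : GreenbergSetting ι W N K v vbar κ₁ κ₂) (hyp : Thm1010bHypotheses W p N K) :
    OrdinaryTwoVariableMainConjectureAt ι₁ W K κ₁ κ₂ γ₁ γ₂ π ∧
      GreenbergTwoVariableMainConjectureAnyRootAt ι W K v vbar κ₁ κ₂ γ₁ γ₂ π.f :=
  ⟨ordinaryAt_of_thm1010b_OPEN_of_thm33 hSt_OPEN h33 ι₁ W κ₁ κ₂ γ₁ γ₂ π hyp,
    GreenbergAnyRoot.of_thm1010b_OPEN_of_thm39 hGr_OPEN h39 ι W v vbar κ₁ κ₂ γ₁ γ₂ π.isNewformOf hS hyp⟩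

end Summit.BirchSwinnertonDyer.Rank1Residual.TwoVariableIMC

end
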